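import Summits.AtomisticToContinuum.Crystallization.Theorems.FrustratedLawDichotomyStrainedPatchHomValueT2SoundZ

/-!
# (I1) slope part B — BOOKKEEPING OF THE SLOPE ACCUMULATOR `accSlope` / the `t2SlopeT2` fold (`…HomValueT2Track` §14b; critic row 1674 (B) (I1) docket
# item 3 `slopeT2_sound`, second instalment; 27623 `(H) HomFloor`, hcp half; decomp-a2c hand-1 g49)

§1 one step: `accSlope` keeps the flag; its `fc` entry adds `β·y_a`, its `jc` entries add `jF` for a Lipschitz-class box record, its integer `hp` / `rp`
entries add the first-order hull resp. the second-order remainder numerator of the label (read through `getD`, any accumulator sizes).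
§2 ★ the fold: final flag `true` ⟹ both records of every label exist, ENTRYWISE MEMBERSHIP of the real label sums in `fc` / `jc`, and the integer
`hp` / `rp` entries ARE the label sums.  No definitions; 0 sorry; standard axioms.  `--supports stmt-AtomisticToContinuum-27623`.
-/

namespace Summit.AtomisticToContinuum.Crystallization.Theorems.FrustratedLawDichotomyStrainedPatchHomValueT2Kit

open Literature.Analysis.ValidatedNumerics.Numerics

/-! ## §1. One step of the slope accumulator -/

section step
variable (aP : Fin 3 → Fin 6 → ℤ) (wf : Array ℤ) (Rp Rb : DRec) (A : AccS)

/-- `accSlope` keeps the flag. [formal bookkeeping] -/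
theorem accSlope_ok : (accSlope aP wf Rp Rb A).ok = A.ok := by
  unfold accSlope; split_ifs <;> rfl

/-- The point-force entry adds `β·y_a`. [formal bookkeeping] -/
theorem accSlope_fc_getD {a : ℕ} (ha : a < 3) :
    (accSlope aP wf Rp Rb A).fc.getD a fi0 = (A.fc.getD a fi0).add (Rp.co.be.mul (Rp.y ⟨a, ha⟩)) := by
  have e : (accSlope aP wf Rp Rb A).fc = Array.ofFn fun a : Fin 3 => (A.fc.getD a.val fi0).add (Rp.co.be.mul (Rp.y a)) := by
    unfold accSlope; split_ifs <;> rfl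
  rw [e, getD_ofFn_lt _ _ ha]

/-- The point-Jacobian entries add `jF` for a Lipschitz-class box record and are unchanged otherwise. [formal bookkeeping] -/
theorem accSlope_jc_getD {n : ℕ} (hn : n < 18) :
    (accSlope aP wf Rp Rb A).jc.getD n fi0 = if Rb.co.lip then (A.jc.getD n fi0).add (jF aP Rp ⟨n / 6, by omega⟩ (n % 6)) else A.jc.getD n fi0 := by
  by_cases h : Rb.co.lip = true
  · have e : (accSlope aP wf Rp Rb A).jc = Array.ofFn fun m : Fin 18 => (A.jc.getD m.val fi0).add (jF aP Rp ⟨m.val / 6, by omega⟩ (m.val % 6)) := by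
      unfold accSlope; rw [if_pos h]
    rw [e, getD_ofFn_lt _ _ hn, if_pos h]
  · have e : (accSlope aP wf Rp Rb A).jc = A.jc := by
      unfold accSlope; rw [if_neg h]
    rw [e, if_neg h]

/-- The integer first-order hull entry adds the junction-class label's `Σ_e |jF|↑ w_e` and is unchanged for a Lipschitz-class label. [formal bookkeeping] -/
theorem accSlope_hp_getD {a : ℕ} (ha : a < 3) :
    (accSlope aP wf Rp Rb A).hp.getD a 0 = A.hp.getD a 0 + (if Rb.co.lip then 0 else (List.range 6).foldl (fun s e => s + (jF aP Rb ⟨a, ha⟩ e).absHi * wf.getD e 0) 0) := by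
  by_cases h : Rb.co.lip = true
  · have e : (accSlope aP wf Rp Rb A).hp = A.hp := by
      unfold accSlope; rw [if_pos h]
    rw [e, if_pos h, add_zero]
  · have e : (accSlope aP wf Rp Rb A).hp = Array.ofFn fun a : Fin 3 => A.hp.getD a.val 0 +
        (List.range 6).foldl (fun s e => s + (jF aP Rb a e).absHi * wf.getD e 0) 0 := by
      unfold accSlope; rw [if_neg h]
    rw [e, getD_ofFn_lt _ _ ha, if_neg h]

/-- The integer remainder entry adds the Lipschitz-class label's second-order numerator and is unchanged for a junction-class label. [formal bookkeeping] -/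
theorem accSlope_rp_getD {a : ℕ} (ha : a < 3) :
    (accSlope aP wf Rp Rb A).rp.getD a 0 = A.rp.getD a 0 + (if Rb.co.lip then (List.range 9).foldl (fun s k => (List.range 9).foldl (fun s2 l => if l < k then s2 else s2 + (if k = l then 1 else 2) * ((ddF Rb ⟨a, ha⟩ k l).absHi * wf.getD k 0 / (SC : ℤ)) * wf.getD l 0) s) 0 else 0) := by
  by_cases h : Rb.co.lip = true
  · have e : (accSlope aP wf Rp Rb A).rp = Array.ofFn fun a : Fin 3 => A.rp.getD a.val 0 +
        (List.range 9).foldl (fun s k => (List.range 9).foldl (fun s2 l =>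
          if l < k then s2 else s2 + (if k = l then 1 else 2) * ((ddF Rb a k l).absHi * wf.getD k 0 / (SC : ℤ)) * wf.getD l 0) s) 0 := by
      unfold accSlope; rw [if_pos h]
    rw [e, getD_ofFn_lt _ _ ha, if_pos h]
  · have e : (accSlope aP wf Rp Rb A).rp = A.rp := by
      unfold accSlope; rw [if_neg h]
    rw [e, if_neg h, add_zero]

end step

/-! ## §2. ★ The slope fold -/

/-- ★★ **THE SLOPE FOLD** (generic in the two record makers): final flag `true` ⟹ the initial flag is `true`, both records of every label exist, for any real
summands lying in the per-label `fc` / `jc` contributions the label sums (added to a member of the initial entry) lie in the final entries, and the integer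
`hp` / `rp` entries are the initial ones plus the label sums of the per-label contributions. [formal bookkeeping] -/
theorem foldl_slope_spec {β : Type*} (aP : Fin 3 → Fin 6 → ℤ) (wf : Array ℤ) (L : List β) (mkP mkB : β → Option DRec) :
    ∀ A : AccS, (L.foldl (fun A b =>
        match mkP b, mkB b with
        | some Rp, some Rb => accSlope aP wf Rp Rb A
        | _, _ => (⟨false, A.fc, A.jc, A.hp, A.rp⟩ : AccS)) A).ok = true →
      A.ok = true ∧ (∀ b ∈ L, ∃ Rp Rb, mkP b = some Rp ∧ mkB b = some Rb) ∧
      (∀ a (ha : a < 3) (f : β → ℝ) (x : ℝ), (∀ b ∈ L, ∀ Rp Rb, mkP b = some Rp → mkB b = some Rb → FI.mem (f b) (Rp.co.be.mul (Rp.y ⟨a, ha⟩))) →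
        FI.mem x (A.fc.getD a fi0) → FI.mem (x + (L.map f).sum) ((L.foldl (fun A b =>
        match mkP b, mkB b with
        | some Rp, some Rb => accSlope aP wf Rp Rb A
        | _, _ => (⟨false, A.fc, A.jc, A.hp, A.rp⟩ : AccS)) A).fc.getD a fi0)) ∧
      (∀ n (hn : n < 18) (f : β → ℝ) (x : ℝ), (∀ b ∈ L, ∀ Rp Rb, mkP b = some Rp → mkB b = some Rb →
          FI.mem (f b) (if Rb.co.lip then jF aP Rp ⟨n / 6, by omega⟩ (n % 6) else fi0)) →
        FI.mem x (A.jc.getD n fi0) → FI.mem (x + (L.map f).sum) ((L.foldl (fun A b =>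
        match mkP b, mkB b with
        | some Rp, some Rb => accSlope aP wf Rp Rb A
        | _, _ => (⟨false, A.fc, A.jc, A.hp, A.rp⟩ : AccS)) A).jc.getD n fi0)) ∧
      (∀ a (ha : a < 3), (L.foldl (fun A b =>
        match mkP b, mkB b with
        | some Rp, some Rb => accSlope aP wf Rp Rb A
        | _, _ => (⟨false, A.fc, A.jc, A.hp, A.rp⟩ : AccS)) A).hp.getD a 0 = A.hp.getD a 0 + (L.map fun b =>
          match mkP b, mkB b with
          | some _, some Rb => if Rb.co.lip then 0 else (List.range 6).foldl (fun s e => s + (jF aP Rb ⟨a, ha⟩ e).absHi * wf.getD e 0) 0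
          | _, _ => 0).sum) ∧
      (∀ a (ha : a < 3), (L.foldl (fun A b =>
        match mkP b, mkB b with
        | some Rp, some Rb => accSlope aP wf Rp Rb A
        | _, _ => (⟨false, A.fc, A.jc, A.hp, A.rp⟩ : AccS)) A).rp.getD a 0 = A.rp.getD a 0 + (L.map fun b =>
          match mkP b, mkB b with
          | some _, some Rb => if Rb.co.lip then (List.range 9).foldl (fun s k => (List.range 9).foldl (fun s2 l => if l < k then s2 else s2 + (if k = l then 1 else 2) * ((ddF Rb ⟨a, ha⟩ k l).absHi * wf.getD k 0 / (SC : ℤ)) * wf.getD l 0) s) 0 else 0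
          | _, _ => 0).sum) := by
  induction L with
  | nil =>
    intro A h
    refine ⟨by simpa using h, by simp, ?_, ?_, ?_, ?_⟩
    · intro a ha f x _ hx; simpa using hx
    · intro n hn f x _ hx; simpa using hx
    · intro a ha; simp
    · intro a ha; simp
  | cons b L ih =>
    intro A h
    cases hP : mkP b with
    | none =>
      simp only [List.foldl_cons, hP] at h
      exact absurd (ih _ h).1 (by simp)
    | some Rp =>
      cases hB : mkB b with
      | none =>
        simp only [List.foldl_cons, hP, hB] at h
        exact absurd (ih _ h).1 (by simp)
      | some Rb =>
        simp only [List.foldl_cons, hP, hB] at h ⊢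
        obtain ⟨hok, hall, hfc, hjc, hhp, hrp⟩ := ih _ h
        rw [accSlope_ok] at hok
        refine ⟨hok, ?_, ?_, ?_, ?_, ?_⟩
        · intro b' hb'
          rcases List.mem_cons.1 hb' with rfl | hmem
          · exact ⟨Rp, Rb, hP, hB⟩
          · exact hall b' hmem
        · intro a ha f x hmem hx
          rw [List.map_cons, List.sum_cons, ← add_assoc]
          refine hfc a ha f (x + f b) (fun b' hb' => hmem b' (List.mem_cons_of_mem _ hb')) ?_
          rw [accSlope_fc_getD aP wf Rp Rb A ha]
          exact FI.mem_add hx (hmem b List.mem_cons_self Rp Rb hP hB)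
        · intro n hn f x hmem hx
          rw [List.map_cons, List.sum_cons, ← add_assoc]
          refine hjc n hn f (x + f b) (fun b' hb' => hmem b' (List.mem_cons_of_mem _ hb')) ?_
          rw [accSlope_jc_getD aP wf Rp Rb A hn]
          have hm := hmem b List.mem_cons_self Rp Rb hP hB
          by_cases hl : Rb.co.lip = true
          · rw [if_pos hl] at hm ⊢; exact FI.mem_add hx hm
          · rw [if_neg hl] at hm ⊢
            have h0 : f b = 0 := by
              have := hm; simp only [FI.mem, fi0, FI.ofInt, zero_mul, Int.cast_zero] at this
              nlinarith [SC_pos, this.1, this.2]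
            rw [h0, add_zero]; exact hx
        · intro a ha
          rw [hhp a ha, accSlope_hp_getD aP wf Rp Rb A ha, List.map_cons, List.sum_cons]
          simp only [hP, hB]
          ring
        · intro a ha
          rw [hrp a ha, accSlope_rp_getD aP wf Rp Rb A ha, List.map_cons, List.sum_cons]
          simp only [hP, hB]
          ring

end Summit.AtomisticToContinuum.Crystallization.Theorems.FrustratedLawDichotomyStrainedPatchHomValueT2Kit
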